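import Summits.Ventures.PercRepro.RankLevelSetThroughMinorFive
import Summits.Ventures.PercRepro.RankLevelSetPerElemFiveSeries

/-! # RankLevelSetUpChain — THE UP-SHADOW CHAIN OF THE THROUGH-`b` PROFILE: (↑) AT EVERY LEVEL ON COLOOP-FREE
MATROIDS OF NULLITY `≤ 3`, AND (↑) AT LEVEL `4` ON COLOOP-FREE MATROIDS OF NULLITY `≤ 4` WITHOUT A SERIES TRIPLE
(night-1 g38; dossier §50; on `RankLevelSetThroughMinorFive` and `RankLevelSetPerElemFiveSeries`)

For `W ∈ D_k` through `b` the up-neighbours `W ∪ {t}` (`t ∈ E ∖ W`, `t ∉ cl W`) are again bi-independent, and the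
elements of `E ∖ W` inside `cl W` are exactly the coloops of `M✶ | (E ∖ W)` (**`compl_closure_eq_dual_coloops`**).
A through-`b` member at level `k + 1` has at most `k` down-neighbours (`W' ∖ {t}`, `t ≠ b`), so with a bound `c₀`
on the coloops: `(#E − k − c₀) · T_k ≤ k · T_{k+1}` (**`upFam_step`**). With `c₀ = 2` the chain telescopes exactly
(`le_of_chain`): `T_k ≤ T_{#E − 1 − k}`, which is (↑) at level `k` (**`upAt_of_bound_two`**). The bound `2` holds
for every spanning complement on a coloop-free matroid of nullity `≤ 3` (`ncard_coloops_add_one_le`) —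
**`upAt_of_nullity_three`** — and, at level `4`, on a coloop-free matroid of nullity `≤ 4` with no series triple
(`ncard_coloops_add_two_le`) — **`upAt_four_of_no_triple`**. NOTE (census, night-1 g38): with a series triple the
step `(#E − k − 2) · T_k ≤ k · T_{k+1}` is FALSE on loopless rank-`4` duals (`U_{4,5}` with parallel classes of sizes
`(1, 2, 3, 3, 3)`, `b` the simple point, `k = 6`: `4 · 297 > 6 · 189`), although (↑) holds there; the series-triple
case needs the decomposition of `RankLevelSetUpSeriesClass`. Every declaration has a docstring; imports: the cell's
own modules and Mathlib only. Axioms: standard. -/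

namespace PercRepro

open Set Matroid

variable {α : Type} (M : Matroid α) [M.Finite]

/-! ## The through-`b` family and the dual reading of the closure -/

/-- The through-`b` family at level `k` is finite. -/
lemma through_finite (b : α) (k : ℕ) : {W ∈ biIndep M k | b ∈ W}.Finite :=
  (biIndep_finite M k).subset (fun _ h => h.1)

omit [M.Finite] in
/-- An independent set of `M` has an `M✶`-spanning complement. -/
lemma dual_spanning_compl_of_indep {W : Set α} (hW : M.Indep W) : M✶.Spanning (M.E \ W) := by
  have h : M✶.Coindep W := by rwa [Matroid.dual_coindep_iff]
  have := h.compl_spanning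
  rwa [Matroid.dual_ground] at this

omit [M.Finite] in
/-- An `M✶`-spanning complement comes from an independent set of `M`. -/
lemma indep_of_dual_spanning_compl {W : Set α} (hWE : W ⊆ M.E) (hW : M✶.Spanning (M.E \ W)) : M.Indep W := by
  rw [← Matroid.dual_coindep_iff, Matroid.coindep_iff_compl_spanning (by rwa [Matroid.dual_ground]),
    Matroid.dual_ground]
  exact hW

omit [M.Finite] in
/-- For a spanning set `Y` of `N` and `t ∈ Y`, `Y ∖ {t}` is spanning iff `t ∈ cl (Y ∖ {t})`. -/
lemma spanning_sdiff_singleton_iff {N : Matroid α} {Y : Set α} (hY : N.Spanning Y) {t : α} (ht : t ∈ Y) :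
    N.Spanning (Y \ {t}) ↔ t ∈ N.closure (Y \ {t}) := by
  constructor
  · intro h
    rw [h.closure_eq]
    exact hY.subset_ground ht
  · intro h
    have h1 : N.closure (insert t (Y \ {t})) = N.closure (Y \ {t}) :=
      Matroid.closure_insert_eq_of_mem_closure h
    rw [Set.insert_sdiff_singleton, Set.insert_eq_of_mem ht, hY.closure_eq] at h1
    exact ⟨by rw [h1], Set.sdiff_subset.trans hY.subset_ground⟩

omit [M.Finite] in
/-- **THE DUAL READING OF THE CLOSURE**: for a bi-independent `W`, the elements of `E ∖ W` inside `cl W` are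
exactly the coloops of `M✶ | (E ∖ W)` (the `t ∈ E ∖ W` with `t ∉ cl✶ ((E ∖ W) ∖ {t})`). -/
lemma compl_closure_eq_dual_coloops {k : ℕ} {W : Set α} (hW : W ∈ biIndep M k) :
    {t ∈ M.E \ W | t ∈ M.closure W} = {t ∈ M.E \ W | t ∉ M✶.closure ((M.E \ W) \ {t})} := by
  obtain ⟨hWE, -, hWi, -⟩ := hW
  have hYsp : M✶.Spanning (M.E \ W) := dual_spanning_compl_of_indep M hWi
  ext t
  simp only [Set.mem_setOf_eq]
  constructor
  · rintro ⟨htY, htcl⟩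
    refine ⟨htY, fun h => ?_⟩
    have hsp := (spanning_sdiff_singleton_iff hYsp htY).mpr h
    have heq : (M.E \ W) \ {t} = M.E \ insert t W := by
      ext x; simp only [Set.mem_sdiff, Set.mem_singleton_iff, Set.mem_insert_iff, not_or]; tauto
    rw [heq] at hsp
    have hind : M.Indep (insert t W) := indep_of_dual_spanning_compl M (Set.insert_subset htY.1 hWE) hsp
    have := (hWi.insert_indep_iff_of_notMem htY.2).mp hind
    exact this.2 htcl
  · rintro ⟨htY, hncl⟩
    refine ⟨htY, ?_⟩
    by_contra hcl
    have hind : M.Indep (insert t W) := (hWi.insert_indep_iff_of_notMem htY.2).mpr ⟨htY.1, hcl⟩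
    have hsp := dual_spanning_compl_of_indep M hind
    have heq : M.E \ insert t W = (M.E \ W) \ {t} := by
      ext x; simp only [Set.mem_sdiff, Set.mem_singleton_iff, Set.mem_insert_iff, not_or]; tauto
    rw [heq] at hsp
    exact hncl ((spanning_sdiff_singleton_iff hYsp htY).mp hsp)

/-! ## The up-shadow step of the through-`b` profile -/

/-- **THE UP-SHADOW STEP OF THE THROUGH-`b` PROFILE WITH A COLOOP BOUND `c₀`**: if for every `W ∈ D_k` through `b`
at most `c₀` elements of `E ∖ W` lie in `cl W`, then `(#E − k − c₀) · T_k ≤ k · T_{k+1}`: every such `W` has at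
least `#E − k − c₀` up-neighbours `W ∪ {t}` in `D_{k+1}` through `b`, and every member at level `k + 1` has at most
`k` down-neighbours `W' ∖ {t}` (`t ≠ b`). -/
theorem upFam_step {b : α} {k c₀ : ℕ}
    (hbound : ∀ W ∈ biIndep M k, b ∈ W → {t ∈ M.E \ W | t ∈ M.closure W}.ncard ≤ c₀) :
    (M.E.ncard - k - c₀) * {W ∈ biIndep M k | b ∈ W}.ncard ≤
      k * {W ∈ biIndep M (k + 1) | b ∈ W}.ncard := by
  classical
  have hAfin := through_finite M b k
  have hBfin := through_finite M b (k + 1)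
  set I : Finset (Set α × Set α) := (hAfin.toFinset ×ˢ hBfin.toFinset).filter (fun p => p.1 ⊆ p.2) with hI
  -- LOWER BOUND
  have hlow : (M.E.ncard - k - c₀) * hAfin.toFinset.card ≤ I.card := by
    refine Finset.mul_card_image_le_card_of_maps_to (f := Prod.fst) ?_ _ ?_
    · intro p hp
      rw [hI, Finset.mem_filter, Finset.mem_product] at hp
      exact hp.1.1
    · intro W hW
      have hWA := hAfin.mem_toFinset.mp hW
      obtain ⟨⟨hWE, hWk, hWi, hWc⟩, hbW⟩ := hWA
      have hWfin : W.Finite := M.ground_finite.subset hWE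
      set Y := M.E \ W with hY
      have hYfin : Y.Finite := M.ground_finite.subset Set.sdiff_subset
      have hYcard : Y.ncard = M.E.ncard - k := by rw [hY, Set.ncard_sdiff' hWE M.ground_finite, hWk]
      have hcol : {t ∈ Y | t ∈ M.closure W}.ncard ≤ c₀ := hbound W ⟨hWE, hWk, hWi, hWc⟩ hbW
      have hmaps : ∀ t ∈ Y \ {t ∈ Y | t ∈ M.closure W},
          (W, insert t W) ∈ I.filter (fun p => p.1 = W) := by
        intro t ht
        have htY : t ∈ Y := ht.1
        have htcl : t ∉ M.closure W := fun h => ht.2 ⟨htY, h⟩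
        rw [Finset.mem_filter, hI, Finset.mem_filter, Finset.mem_product]
        refine ⟨⟨⟨hW, ?_⟩, Set.subset_insert t W⟩, rfl⟩
        rw [hBfin.mem_toFinset]
        refine ⟨⟨Set.insert_subset htY.1 hWE, ?_, ?_, ?_⟩, Set.mem_insert_of_mem t hbW⟩
        · rw [Set.ncard_insert_of_notMem htY.2 hWfin, hWk]
        · exact (hWi.insert_indep_iff_of_notMem htY.2).mpr ⟨htY.1, htcl⟩
        · exact hWc.subset (Set.sdiff_subset_sdiff_right (Set.subset_insert t W))
      have hinj : Set.InjOn (fun t => (W, insert t W)) (Y \ {t ∈ Y | t ∈ M.closure W}) := by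
        intro t₁ ht₁ t₂ ht₂ heq
        have h : insert t₁ W = insert t₂ W := congrArg Prod.snd heq
        have : t₁ ∈ insert t₂ W := h ▸ Set.mem_insert t₁ W
        rcases this with h' | h'
        · exact h'
        · exact absurd h' ht₁.1.2
      have hcard1 : (Y \ {t ∈ Y | t ∈ M.closure W}).ncard = Y.ncard - {t ∈ Y | t ∈ M.closure W}.ncard :=
        Set.ncard_sdiff (fun t ht => ht.1) (hYfin.subset (fun t ht => ht.1))
      calc M.E.ncard - k - c₀ ≤ (Y \ {t ∈ Y | t ∈ M.closure W}).ncard := by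
            rw [hcard1, hYcard]; omega
        _ = ((fun t => (W, insert t W)) '' (Y \ {t ∈ Y | t ∈ M.closure W})).ncard :=
            hinj.ncard_image.symm
        _ ≤ (I.filter (fun p => p.1 = W)).card := by
            rw [← Set.ncard_coe_finset]
            refine Set.ncard_le_ncard ?_ (Finset.finite_toSet _)
            rintro p ⟨t, ht, rfl⟩
            exact hmaps t ht
  -- UPPER BOUND
  have hup : I.card ≤ k * hBfin.toFinset.card := by
    refine Finset.card_le_mul_card_image_of_maps_to (f := Prod.snd) ?_ _ ?_
    · intro p hp
      rw [hI, Finset.mem_filter, Finset.mem_product] at hp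
      exact hp.1.2
    · intro W' hW'
      have hW'B := hBfin.mem_toFinset.mp hW'
      have hW'fin : W'.Finite := M.ground_finite.subset hW'B.1.1
      have hex : ∀ p ∈ I.filter (fun p => p.2 = W'), ∃ t ∈ W' \ {b}, p.1 = W' \ {t} := by
        intro p hp
        rw [Finset.mem_filter, hI, Finset.mem_filter, Finset.mem_product] at hp
        obtain ⟨⟨⟨hpA, -⟩, hsub⟩, hp2⟩ := hp
        rw [hp2] at hsub
        have hpA' := hAfin.mem_toFinset.mp hpA
        have h1 : (W' \ p.1).ncard = 1 := by
          rw [Set.ncard_sdiff hsub (M.ground_finite.subset hpA'.1.1), hW'B.1.2.1, hpA'.1.2.1]; omega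
        obtain ⟨t, ht⟩ := Set.ncard_eq_one.mp h1
        have htW' : t ∈ W' \ p.1 := by rw [ht]; exact Set.mem_singleton t
        refine ⟨t, ⟨htW'.1, fun hb => htW'.2 (by rw [Set.mem_singleton_iff] at hb; rw [hb]; exact hpA'.2)⟩, ?_⟩
        ext x
        constructor
        · intro hx
          exact ⟨hsub hx, fun h => htW'.2 (by rw [Set.mem_singleton_iff] at h; rw [← h]; exact hx)⟩
        · intro hx
          by_contra hxp
          have : x ∈ W' \ p.1 := ⟨hx.1, hxp⟩
          rw [ht, Set.mem_singleton_iff] at this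
          exact hx.2 (by rw [this]; exact Set.mem_singleton t)
      choose g hg using hex
      set g' : Set α × Set α → α := fun p => if h : p ∈ I.filter (fun p => p.2 = W') then g p h else b with hg'
      have hg'eq : ∀ p (hp : p ∈ I.filter (fun p => p.2 = W')), g' p = g p hp := by
        intro p hp
        simp only [hg', dif_pos hp]
      have hWbfin : (W' \ {b}).Finite := hW'fin.subset Set.sdiff_subset
      calc (I.filter (fun p => p.2 = W')).card ≤ hWbfin.toFinset.card := by
            refine Finset.card_le_card_of_injOn g' ?_ ?_
            · intro p hp
              rw [Finset.mem_coe] at hp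
              rw [Finset.mem_coe, hWbfin.mem_toFinset, hg'eq p hp]
              exact (hg p hp).1
            · intro p hp q hq heq
              rw [Finset.mem_coe] at hp hq
              rw [hg'eq p hp, hg'eq q hq] at heq
              have hp' := Finset.mem_filter.mp hp
              have hq' := Finset.mem_filter.mp hq
              refine Prod.ext ?_ (hp'.2.trans hq'.2.symm)
              rw [(hg p hp).2, (hg q hq).2, heq]
        _ = k := by
          rw [← Set.ncard_eq_toFinset_card _ hWbfin, Set.ncard_sdiff_singleton_of_mem hW'B.2, hW'B.1.2.1]
          rfl
  rw [Set.ncard_eq_toFinset_card _ hAfin, Set.ncard_eq_toFinset_card _ hBfin]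
  exact hlow.trans hup

/-! ## The chain -/

/-- **(↑) AT LEVEL `k` FROM THE COLOOP BOUND `2` ALONG THE CHAIN**: if every through-`b` member `W` at the levels
`k ≤ j ≤ #E − 2 − k` has at most `2` elements of `E ∖ W` in `cl W`, then the steps `(#E − j − 2) · T_j ≤ j · T_{j+1}`
telescope exactly to `T_k ≤ T_{#E − 1 − k}`, i.e. `BiIndepUpAt M b k`. -/
theorem upAt_of_bound_two {b : α} (hb : b ∈ M.E) {k : ℕ} (hk1 : 1 ≤ k) (hk : 2 * k + 2 ≤ M.E.ncard)
    (hbound : ∀ j, k ≤ j → j + k + 2 ≤ M.E.ncard →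
      ∀ W ∈ biIndep M j, b ∈ W → {t ∈ M.E \ W | t ∈ M.closure W}.ncard ≤ 2) :
    BiIndepUpAt M b k := by
  rw [upAt_iff_through_le_through M hb (by omega)]
  let f : ℕ → ℕ := fun i => {W ∈ biIndep M (i + 1) | b ∈ W}.ncard
  have hstep : ∀ t, t < M.E.ncard - 1 - 2 * k →
      (M.E.ncard - k - 2 - t) * f (k - 1 + t) ≤ (k - 1 + t + 1) * f (k - 1 + t + 1) := by
    intro t ht
    have e1 : k - 1 + t + 1 = k + t := by omega
    have e2 : M.E.ncard - k - 2 - t = M.E.ncard - (k + t) - 2 := by omega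
    show (M.E.ncard - k - 2 - t) * {W ∈ biIndep M (k - 1 + t + 1) | b ∈ W}.ncard ≤
      (k - 1 + t + 1) * {W ∈ biIndep M (k - 1 + t + 1 + 1) | b ∈ W}.ncard
    rw [e1, e2]
    exact upFam_step M (b := b) (k := k + t) (c₀ := 2) (hbound (k + t) (by omega) (by omega))
  have hchain := le_of_chain f (a := k - 1) (c := M.E.ncard - k - 2) (m := M.E.ncard - 1 - 2 * k)
    (by omega) hstep
  have h1 : f (k - 1) = {W ∈ biIndep M k | b ∈ W}.ncard := by
    show {W ∈ biIndep M (k - 1 + 1) | b ∈ W}.ncard = _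
    rw [Nat.sub_add_cancel hk1]
  have h2 : f (k - 1 + (M.E.ncard - 1 - 2 * k)) = {W ∈ biIndep M (M.E.ncard - 1 - k) | b ∈ W}.ncard := by
    show {W ∈ biIndep M (k - 1 + (M.E.ncard - 1 - 2 * k) + 1) | b ∈ W}.ncard = _
    have e : k - 1 + (M.E.ncard - 1 - 2 * k) + 1 = M.E.ncard - 1 - k := by omega
    rw [e]
  rw [← h1, ← h2]
  exact hchain

omit [M.Finite] in
/-- Every element of a coloop-free matroid is a nonloop of the dual. -/
lemma dual_isNonloop_of_coloopFree (hcol : ∀ e, ¬ M.IsColoop e) {e : α} (he : e ∈ M.E) : M✶.IsNonloop e := by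
  refine Matroid.isNonloop_of_not_isLoop (by rwa [Matroid.dual_ground]) ?_
  rw [Matroid.dual_isLoop_iff_isColoop]
  exact hcol e

/-- **THE COLOOP BOUND ON A COLOOP-FREE MATROID OF NULLITY `≤ 3`**: for a bi-independent `W` with `#E − #W ≥ 4`, at
most `2` elements of `E ∖ W` lie in `cl W` (`ncard_coloops_add_one_le` in the dual, `ρ = 3`). -/
lemma bound_two_of_nullity_three (hcol : ∀ e, ¬ M.IsColoop e) (hν : M✶.eRank ≤ 3) {j : ℕ} {W : Set α}
    (hW : W ∈ biIndep M j) (hj : j + 4 ≤ M.E.ncard) :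
    {t ∈ M.E \ W | t ∈ M.closure W}.ncard ≤ 2 := by
  rw [compl_closure_eq_dual_coloops M hW]
  have hYE : M.E \ W ⊆ M✶.E := by rw [Matroid.dual_ground]; exact Set.sdiff_subset
  have hcard : (M.E \ W).ncard = M.E.ncard - j := by
    rw [Set.ncard_sdiff' hW.1 M.ground_finite, hW.2.1]
  have h := ncard_coloops_add_one_le (N := M✶) hYE
    (fun e he => dual_isNonloop_of_coloopFree M hcol he.1)
    (ρ := 3) ((M✶.eRk_le_eRank _).trans hν) (by omega)
  omega

/-- **(↑) AT EVERY LEVEL `k ≥ 2` ON A COLOOP-FREE MATROID OF NULLITY `≤ 3`** (`2k + 2 ≤ #E`): the chain with the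
coloop bound `2`. -/
theorem upAt_of_nullity_three (hcol : ∀ e, ¬ M.IsColoop e) (hν : M✶.eRank ≤ 3) {b : α} (hb : b ∈ M.E)
    {k : ℕ} (hk2 : 2 ≤ k) (hk : 2 * k + 2 ≤ M.E.ncard) : BiIndepUpAt M b k := by
  refine upAt_of_bound_two M hb (by omega) hk ?_
  intro j hkj hj W hW _
  exact bound_two_of_nullity_three M hcol hν hW (by omega)

/-- **THE COLOOP BOUND ON A COLOOP-FREE MATROID OF NULLITY `≤ 4` WITHOUT A SERIES TRIPLE**: for a bi-independent `W`
with `#E − #W ≥ 6`, at most `2` elements of `E ∖ W` lie in `cl W` (`ncard_coloops_add_two_le` in the dual, `ρ = 4`). -/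
lemma bound_two_of_no_triple (hcol : ∀ e, ¬ M.IsColoop e) (hν : M✶.eRank ≤ 4) (hnt : NoSeriesTriple M)
    {j : ℕ} {W : Set α} (hW : W ∈ biIndep M j) (hj : j + 6 ≤ M.E.ncard) :
    {t ∈ M.E \ W | t ∈ M.closure W}.ncard ≤ 2 := by
  rw [compl_closure_eq_dual_coloops M hW]
  have hYE : M.E \ W ⊆ M✶.E := by rw [Matroid.dual_ground]; exact Set.sdiff_subset
  have hcard : (M.E \ W).ncard = M.E.ncard - j := by
    rw [Set.ncard_sdiff' hW.1 M.ground_finite, hW.2.1]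
  have h := ncard_coloops_add_two_le (N := M✶) hYE
    (fun e he => dual_isNonloop_of_coloopFree M hcol he.1)
    (fun p hp q hq r hr hpq hpr hqr hqp hrp =>
      hnt p q r hpq hpr hqr (dual_isNonloop_of_coloopFree M hcol hp.1) hqp hrp)
    (ρ := 4) ((M✶.eRk_le_eRank _).trans hν) (by omega)
  omega

/-- **(↑) AT EVERY LEVEL `k ≥ 4` ON A COLOOP-FREE MATROID OF NULLITY `≤ 4` WITHOUT A SERIES TRIPLE**
(`2k + 2 ≤ #E`): the refined chain with the coloop bound `2`. -/
theorem upAt_of_no_triple (hcol : ∀ e, ¬ M.IsColoop e) (hν : M✶.eRank ≤ 4) (hnt : NoSeriesTriple M) {b : α}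
    (hb : b ∈ M.E) {k : ℕ} (hk4 : 4 ≤ k) (hk : 2 * k + 2 ≤ M.E.ncard) : BiIndepUpAt M b k := by
  refine upAt_of_bound_two M hb (by omega) hk ?_
  intro j hkj hj W hW _
  exact bound_two_of_no_triple M hcol hν hnt hW (by omega)

/-- **(↑) AT LEVEL `4` ON A COLOOP-FREE MATROID OF NULLITY `≤ 4` WITHOUT A SERIES TRIPLE** (`10 ≤ #E`). -/
theorem upAt_four_of_no_triple (hcol : ∀ e, ¬ M.IsColoop e) (hν : M✶.eRank ≤ 4) (hnt : NoSeriesTriple M)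
    {b : α} (hb : b ∈ M.E) (hn : 10 ≤ M.E.ncard) : BiIndepUpAt M b 4 :=
  upAt_of_no_triple M hcol hν hnt hb le_rfl (by omega)

end PercRepro
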